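import Mathlib
import HarnessLib

/-!
# Wedge cap for `GromovRecognitionRelEnd` — coordinate calculus on `ℝ⁴ = ℂ²`
(stub `stub_capModel` of line `cross-cap-laurent`, crux `SymplecticOrigami.GromovRecognitionRelEnd`,
item stmt-SmoothPoincare4-11009; first auxiliary file)

The wedge cap closes the standard end `{‖z‖ > R₁}` of `ℂ² = ℝ⁴` by the two spheres at infinity
`{z₁ = ∞}`, `{z₂ = ∞}` of `ℂP¹ × ℂP¹`, using the complex inversions `z₁ ↦ 1/z₁`, `z₂ ↦ 1/z₂` as
transition maps. This file is the elementary real-coordinate calculus of these maps on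
`E4 = EuclideanSpace ℝ (Fin 4)` (coordinates `0,1` = `z₁`, `2,3` = `z₂`):

* `r1 p = p₀² + p₁² = |z₁|²`, `r2 p = p₂² + p₃² = |z₂|²`;
* `inv1 p = (z̄₁/|z₁|², z₂) = (1/z₁, z₂)` and `inv2` (written with the junk value `x/0 = 0`,
  exactly as in the registered signature of the stub), involutions off the axes, commuting;
* `I4 q = (-q₁, q₀, -q₃, q₂) = i ⊕ i`, the standard complex structure;
* the derivative of `inv1`/`inv2` in coordinates (`fderiv_inv1_apply`): multiplication by
  `-1/z₁² = a1 + i b1` on the `z₁`-plane (so complex linear, `|a1 + i b1|² = |z₁|⁻⁴`).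
-/

noncomputable section

-- the registered namespace `Summit.SmoothPoincare4.SmoothPoincare4.Theorems…` repeats a component
set_option linter.dupNamespace false

open scoped Manifold ContDiff Topology
open Set

namespace Summit.SmoothPoincare4.SmoothPoincare4.Theorems.GromovRecognitionRelEnd.CrossCapLaurent

namespace CapModel

/-- Model space `ℝ⁴ = ℂ²` (coordinates `0,1` = `z₁`, `2,3` = `z₂`). -/
local notation "E4" => EuclideanSpace ℝ (Fin 4)

/-! ## The two squared moduli -/

/-- `|z₁|² = p₀² + p₁²`. [folklore] -/
def r1 (p : E4) : ℝ := p 0 ^ 2 + p 1 ^ 2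

/-- `|z₂|² = p₂² + p₃²`. [folklore] -/
def r2 (p : E4) : ℝ := p 2 ^ 2 + p 3 ^ 2

/-- Unfolding `r1`. [folklore] -/
theorem r1_def (p : E4) : r1 p = p 0 ^ 2 + p 1 ^ 2 := rfl
/-- Unfolding `r2`. [folklore] -/
theorem r2_def (p : E4) : r2 p = p 2 ^ 2 + p 3 ^ 2 := rfl

/-- `|z₁|² ≥ 0`. [folklore] -/
theorem r1_nonneg (p : E4) : 0 ≤ r1 p := by unfold r1; positivity
/-- `|z₂|² ≥ 0`. [folklore] -/
theorem r2_nonneg (p : E4) : 0 ≤ r2 p := by unfold r2; positivity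

/-- `‖p‖² = |z₁|² + |z₂|²`. [folklore] -/
theorem norm_sq_eq_r1_add_r2 (p : E4) : ‖p‖ ^ 2 = r1 p + r2 p := by
  rw [EuclideanSpace.real_norm_sq_eq, Fin.sum_univ_four, r1, r2]
  ring

/-- `|z₁|² ≤ ‖p‖²`. [folklore] -/
theorem r1_le_norm_sq (p : E4) : r1 p ≤ ‖p‖ ^ 2 := by
  rw [norm_sq_eq_r1_add_r2]; linarith [r2_nonneg p]

/-- `|z₂|² ≤ ‖p‖²`. [folklore] -/
theorem r2_le_norm_sq (p : E4) : r2 p ≤ ‖p‖ ^ 2 := by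
  rw [norm_sq_eq_r1_add_r2]; linarith [r1_nonneg p]

/-- `|z₁|² = 0 ↔ z₁ = 0`. [folklore] -/
theorem r1_eq_zero_iff (p : E4) : r1 p = 0 ↔ p 0 = 0 ∧ p 1 = 0 := by
  unfold r1
  constructor
  · intro h
    have h0 : p 0 ^ 2 = 0 := by nlinarith [sq_nonneg (p 0), sq_nonneg (p 1)]
    have h1 : p 1 ^ 2 = 0 := by nlinarith [sq_nonneg (p 0), sq_nonneg (p 1)]
    exact ⟨pow_eq_zero_iff (n := 2) (by norm_num) |>.1 h0, pow_eq_zero_iff (n := 2) (by norm_num) |>.1 h1⟩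
  · rintro ⟨h0, h1⟩; simp [h0, h1]

/-- `|z₂|² = 0 ↔ z₂ = 0`. [folklore] -/
theorem r2_eq_zero_iff (p : E4) : r2 p = 0 ↔ p 2 = 0 ∧ p 3 = 0 := by
  unfold r2
  constructor
  · intro h
    have h0 : p 2 ^ 2 = 0 := by nlinarith [sq_nonneg (p 2), sq_nonneg (p 3)]
    have h1 : p 3 ^ 2 = 0 := by nlinarith [sq_nonneg (p 2), sq_nonneg (p 3)]
    exact ⟨pow_eq_zero_iff (n := 2) (by norm_num) |>.1 h0, pow_eq_zero_iff (n := 2) (by norm_num) |>.1 h1⟩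
  · rintro ⟨h0, h1⟩; simp [h0, h1]

/-- `|z₁|² ≠ 0 ↔ (p₀ ≠ 0 ∨ p₁ ≠ 0)` (the off-axis condition of the signature). [folklore] -/
theorem r1_ne_zero_iff (p : E4) : r1 p ≠ 0 ↔ (p 0 ≠ 0 ∨ p 1 ≠ 0) := by
  rw [Ne, r1_eq_zero_iff]; tauto

/-- `|z₂|² ≠ 0 ↔ (p₂ ≠ 0 ∨ p₃ ≠ 0)`. [folklore] -/
theorem r2_ne_zero_iff (p : E4) : r2 p ≠ 0 ↔ (p 2 ≠ 0 ∨ p 3 ≠ 0) := by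
  rw [Ne, r2_eq_zero_iff]; tauto

/-- The coordinate functions are smooth. [folklore] -/
theorem contDiff_coord (i : Fin 4) : ContDiff ℝ ∞ fun x : E4 => x i :=
  contDiff_euclidean.1 contDiff_id i

/-- `r1` is smooth. [folklore] -/
theorem contDiff_r1 : ContDiff ℝ ∞ r1 :=
  ((contDiff_coord 0).pow 2).add ((contDiff_coord 1).pow 2)

/-- `r2` is smooth. [folklore] -/
theorem contDiff_r2 : ContDiff ℝ ∞ r2 :=
  ((contDiff_coord 2).pow 2).add ((contDiff_coord 3).pow 2)

/-- `r1` is continuous. [folklore] -/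
theorem continuous_r1 : Continuous r1 := contDiff_r1.continuous
/-- `r2` is continuous. [folklore] -/
theorem continuous_r2 : Continuous r2 := contDiff_r2.continuous

/-! ## The complex inversions of the two factors -/

/-- `inv1 (z₁, z₂) = (1/z₁, z₂)` in real coordinates, `1/z₁ = z̄₁/|z₁|²` (junk `0 ↦ 0`); this is
literally the term of the registered signature. [folklore] -/
def inv1 (p : E4) : E4 :=
  WithLp.toLp 2 ![p 0 / (p 0 ^ 2 + p 1 ^ 2), -(p 1) / (p 0 ^ 2 + p 1 ^ 2), p 2, p 3]

/-- `inv2 (z₁, z₂) = (z₁, 1/z₂)` in real coordinates (junk `0 ↦ 0`). [folklore] -/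
def inv2 (p : E4) : E4 :=
  WithLp.toLp 2 ![p 0, p 1, p 2 / (p 2 ^ 2 + p 3 ^ 2), -(p 3) / (p 2 ^ 2 + p 3 ^ 2)]

/-- Coordinate `0` of `inv1`. [folklore] -/
@[simp] theorem inv1_apply0 (p : E4) : inv1 p 0 = p 0 / r1 p := by simp [inv1, r1]
/-- Coordinate `1` of `inv1`. [folklore] -/
@[simp] theorem inv1_apply1 (p : E4) : inv1 p 1 = -(p 1) / r1 p := by simp [inv1, r1]
/-- Coordinate `2` of `inv1`. [folklore] -/
@[simp] theorem inv1_apply2 (p : E4) : inv1 p 2 = p 2 := by simp [inv1]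
/-- Coordinate `3` of `inv1`. [folklore] -/
@[simp] theorem inv1_apply3 (p : E4) : inv1 p 3 = p 3 := by simp [inv1]
/-- Coordinate `0` of `inv2`. [folklore] -/
@[simp] theorem inv2_apply0 (p : E4) : inv2 p 0 = p 0 := by simp [inv2]
/-- Coordinate `1` of `inv2`. [folklore] -/
@[simp] theorem inv2_apply1 (p : E4) : inv2 p 1 = p 1 := by simp [inv2]
/-- Coordinate `2` of `inv2`. [folklore] -/
@[simp] theorem inv2_apply2 (p : E4) : inv2 p 2 = p 2 / r2 p := by simp [inv2, r2]
/-- Coordinate `3` of `inv2`. [folklore] -/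
@[simp] theorem inv2_apply3 (p : E4) : inv2 p 3 = -(p 3) / r2 p := by simp [inv2, r2]

/-- `|1/z₁|² = |z₁|⁻²` (also with the junk values). [folklore] -/
theorem r1_inv1 (p : E4) : r1 (inv1 p) = (r1 p)⁻¹ := by
  by_cases h : r1 p = 0
  · obtain ⟨h0, h1⟩ := (r1_eq_zero_iff p).1 h
    simp [r1_def, h0, h1]
  · rw [r1_def, inv1_apply0, inv1_apply1]
    field_simp
    rw [r1_def]

/-- `inv1` does not move `z₂`. [folklore] -/
@[simp] theorem r2_inv1 (p : E4) : r2 (inv1 p) = r2 p := by simp [r2_def]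

/-- `inv2` does not move `z₁`. [folklore] -/
@[simp] theorem r1_inv2 (p : E4) : r1 (inv2 p) = r1 p := by simp [r1_def]

/-- `|1/z₂|² = |z₂|⁻²`. [folklore] -/
theorem r2_inv2 (p : E4) : r2 (inv2 p) = (r2 p)⁻¹ := by
  by_cases h : r2 p = 0
  · obtain ⟨h0, h1⟩ := (r2_eq_zero_iff p).1 h
    simp [r2_def, h0, h1]
  · rw [r2_def, inv2_apply2, inv2_apply3]
    field_simp
    rw [r2_def]

/-- `inv1` is an involution off the axis `z₁ = 0`. [folklore] -/
theorem inv1_inv1 {p : E4} (h : r1 p ≠ 0) : inv1 (inv1 p) = p := by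
  have h' : r1 (inv1 p) ≠ 0 := by rw [r1_inv1]; exact inv_ne_zero h
  ext i
  fin_cases i
  · show inv1 (inv1 p) 0 = p 0
    rw [inv1_apply0, r1_inv1, inv1_apply0]; field_simp
  · show inv1 (inv1 p) 1 = p 1
    rw [inv1_apply1, r1_inv1, inv1_apply1]; field_simp
  · show inv1 (inv1 p) 2 = p 2
    simp
  · show inv1 (inv1 p) 3 = p 3
    simp

/-- `inv2` is an involution off the axis `z₂ = 0`. [folklore] -/
theorem inv2_inv2 {p : E4} (h : r2 p ≠ 0) : inv2 (inv2 p) = p := by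
  ext i
  fin_cases i
  · show inv2 (inv2 p) 0 = p 0
    simp
  · show inv2 (inv2 p) 1 = p 1
    simp
  · show inv2 (inv2 p) 2 = p 2
    rw [inv2_apply2, r2_inv2, inv2_apply2]; field_simp
  · show inv2 (inv2 p) 3 = p 3
    rw [inv2_apply3, r2_inv2, inv2_apply3]; field_simp

/-- The two inversions commute. [folklore] -/
theorem inv1_inv2 (p : E4) : inv1 (inv2 p) = inv2 (inv1 p) := by
  ext i
  fin_cases i
  · show inv1 (inv2 p) 0 = inv2 (inv1 p) 0
    simp
  · show inv1 (inv2 p) 1 = inv2 (inv1 p) 1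
    simp
  · show inv1 (inv2 p) 2 = inv2 (inv1 p) 2
    simp
  · show inv1 (inv2 p) 3 = inv2 (inv1 p) 3
    simp

/-- `inv1` is smooth off the axis `z₁ = 0`. [folklore] -/
theorem contDiffOn_inv1 : ContDiffOn ℝ ∞ inv1 {p | r1 p ≠ 0} := by
  have h := fun i => (contDiff_coord i).contDiffOn (s := {p : E4 | r1 p ≠ 0})
  have hr : ContDiffOn ℝ ∞ r1 {p : E4 | r1 p ≠ 0} := contDiff_r1.contDiffOn
  rw [contDiffOn_euclidean]
  intro i
  fin_cases i
  · simpa [inv1, r1_def, Pi.div_def] using (h 0).div hr fun p hp => hp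
  · simpa [inv1, r1_def, Pi.div_def, neg_div] using (h 1).neg.div hr fun p hp => hp
  · simpa [inv1] using h 2
  · simpa [inv1] using h 3

/-- `inv2` is smooth off the axis `z₂ = 0`. [folklore] -/
theorem contDiffOn_inv2 : ContDiffOn ℝ ∞ inv2 {p | r2 p ≠ 0} := by
  have h := fun i => (contDiff_coord i).contDiffOn (s := {p : E4 | r2 p ≠ 0})
  have hr : ContDiffOn ℝ ∞ r2 {p : E4 | r2 p ≠ 0} := contDiff_r2.contDiffOn
  rw [contDiffOn_euclidean]
  intro i
  fin_cases i
  · simpa [inv2] using h 0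
  · simpa [inv2] using h 1
  · simpa [inv2, r2_def, Pi.div_def] using (h 2).div hr fun p hp => hp
  · simpa [inv2, r2_def, Pi.div_def, neg_div] using (h 3).neg.div hr fun p hp => hp

/-- `{r1 ≠ 0}` is open. [folklore] -/
theorem isOpen_r1_ne : IsOpen {p : E4 | r1 p ≠ 0} := isOpen_ne_fun continuous_r1 continuous_const

/-- `{r2 ≠ 0}` is open. [folklore] -/
theorem isOpen_r2_ne : IsOpen {p : E4 | r2 p ≠ 0} := isOpen_ne_fun continuous_r2 continuous_const

/-- `inv1` is `C^∞` at every point off the axis. [folklore] -/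
theorem contDiffAt_inv1 {p : E4} (h : r1 p ≠ 0) : ContDiffAt ℝ ∞ inv1 p :=
  contDiffOn_inv1.contDiffAt (isOpen_r1_ne.mem_nhds h)

/-- `inv2` is `C^∞` at every point off the axis. [folklore] -/
theorem contDiffAt_inv2 {p : E4} (h : r2 p ≠ 0) : ContDiffAt ℝ ∞ inv2 p :=
  contDiffOn_inv2.contDiffAt (isOpen_r2_ne.mem_nhds h)

/-! ## The derivatives of the inversions, in coordinates -/

/-- The coordinate projections as continuous linear maps. [folklore] -/
abbrev pr (i : Fin 4) : E4 →L[ℝ] ℝ := PiLp.proj 2 (fun _ : Fin 4 => ℝ) i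

/-- Coordinate projections are their own derivatives. [folklore] -/
theorem hasFDerivAt_coord (i : Fin 4) (y : E4) : HasFDerivAt (fun x : E4 => x i) (pr i) y :=
  (pr i).hasFDerivAt

/-- `d(|z₁|²) = 2 p₀ dp₀ + 2 p₁ dp₁`. [folklore] -/
theorem hasFDerivAt_r1 (p : E4) :
    HasFDerivAt r1 (p 0 • pr 0 + p 0 • pr 0 + (p 1 • pr 1 + p 1 • pr 1)) p := by
  have h := ((hasFDerivAt_coord 0 p).mul (hasFDerivAt_coord 0 p)).add
    ((hasFDerivAt_coord 1 p).mul (hasFDerivAt_coord 1 p))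
  have hr : r1 = fun x : E4 => x 0 * x 0 + x 1 * x 1 := by funext x; simp [r1, sq]
  rw [hr]
  simpa [Pi.mul_def, Pi.add_def] using h

/-- `d(|z₂|²) = 2 p₂ dp₂ + 2 p₃ dp₃`. [folklore] -/
theorem hasFDerivAt_r2 (p : E4) :
    HasFDerivAt r2 (p 2 • pr 2 + p 2 • pr 2 + (p 3 • pr 3 + p 3 • pr 3)) p := by
  have h := ((hasFDerivAt_coord 2 p).mul (hasFDerivAt_coord 2 p)).add
    ((hasFDerivAt_coord 3 p).mul (hasFDerivAt_coord 3 p))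
  have hr : r2 = fun x : E4 => x 2 * x 2 + x 3 * x 3 := by funext x; simp [r2, sq]
  rw [hr]
  simpa [Pi.mul_def, Pi.add_def] using h

/-- Real part of `-1/z₁² = d(1/z₁)/dz₁`: `(p₁² - p₀²)/|z₁|⁴`. [folklore] -/
def a1 (p : E4) : ℝ := (p 1 ^ 2 - p 0 ^ 2) / r1 p ^ 2

/-- Imaginary part of `-1/z₁²`: `2 p₀ p₁/|z₁|⁴`. [folklore] -/
def b1 (p : E4) : ℝ := 2 * p 0 * p 1 / r1 p ^ 2

/-- Real part of `-1/z₂²`. [folklore] -/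
def a2 (p : E4) : ℝ := (p 3 ^ 2 - p 2 ^ 2) / r2 p ^ 2

/-- Imaginary part of `-1/z₂²`. [folklore] -/
def b2 (p : E4) : ℝ := 2 * p 2 * p 3 / r2 p ^ 2

/-- `|d(1/z₁)/dz₁|² = |z₁|⁻⁴`: `a1² + b1² = |z₁|⁻⁴`. [folklore] -/
theorem a1_sq_add_b1_sq {p : E4} (h : r1 p ≠ 0) : a1 p ^ 2 + b1 p ^ 2 = ((r1 p)⁻¹) ^ 2 := by
  simp only [a1, b1]
  field_simp
  rw [r1_def]; ring

/-- `a2² + b2² = |z₂|⁻⁴`. [folklore] -/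
theorem a2_sq_add_b2_sq {p : E4} (h : r2 p ≠ 0) : a2 p ^ 2 + b2 p ^ 2 = ((r2 p)⁻¹) ^ 2 := by
  simp only [a2, b2]
  field_simp
  rw [r2_def]; ring

/-- `inv1` is differentiable off the axis. [folklore] -/
theorem differentiableAt_inv1 {p : E4} (h : r1 p ≠ 0) : DifferentiableAt ℝ inv1 p :=
  (contDiffAt_inv1 h).differentiableAt (by simp)

/-- `inv2` is differentiable off the axis. [folklore] -/
theorem differentiableAt_inv2 {p : E4} (h : r2 p ≠ 0) : DifferentiableAt ℝ inv2 p :=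
  (contDiffAt_inv2 h).differentiableAt (by simp)

/-- **The derivative of `inv1` in coordinates** (`z₁ ↦ 1/z₁` has derivative `-1/z₁² = a1 + i b1`,
acting complex-linearly on `dz₁`, identity on `dz₂`). [folklore] -/
theorem fderiv_inv1_apply {p : E4} (h : r1 p ≠ 0) (v : E4) :
    fderiv ℝ inv1 p v 0 = a1 p * v 0 - b1 p * v 1 ∧
      fderiv ℝ inv1 p v 1 = b1 p * v 0 + a1 p * v 1 ∧
      fderiv ℝ inv1 p v 2 = v 2 ∧ fderiv ℝ inv1 p v 3 = v 3 := by
  have hd := differentiableAt_inv1 h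
  have hD : ∀ i, HasFDerivAt (fun x => inv1 x i) (pr i ∘L fderiv ℝ inv1 p) p := fun i =>
    (hasFDerivWithinAt_euclidean.1 hd.hasFDerivAt.hasFDerivWithinAt i).hasFDerivAt_of_univ
  set N : E4 →L[ℝ] ℝ := p 0 • pr 0 + p 0 • pr 0 + (p 1 • pr 1 + p 1 • pr 1) with hN
  set Q : E4 →L[ℝ] ℝ := (-(r1 p ^ 2)⁻¹) • N with hQ
  have hinv : HasFDerivAt (fun x => (r1 x)⁻¹) Q p := by
    have := (hasDerivAt_inv h).comp_hasFDerivAt p (hasFDerivAt_r1 p)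
    exact this.congr_fderiv (by ext v; simp [hQ, hN])
  have hNv : N v = 2 * (p 0 * v 0 + p 1 * v 1) := by
    simp [hN]; ring
  have hQv : Q v = -(r1 p ^ 2)⁻¹ * (2 * (p 0 * v 0 + p 1 * v 1)) := by
    simp only [hQ, FunLike.coe_smul, Pi.smul_apply, hNv, smul_eq_mul]
  have h0 : HasFDerivAt (fun x => inv1 x 0) ((r1 p)⁻¹ • pr 0 + p 0 • Q) p := by
    simpa [Pi.mul_def, div_eq_inv_mul] using hinv.mul (hasFDerivAt_coord 0 p)
  have h1 : HasFDerivAt (fun x => inv1 x 1) (-((r1 p)⁻¹ • pr 1 + p 1 • Q)) p := by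
    simpa [Pi.mul_def, div_eq_inv_mul, neg_div, Pi.neg_def] using
      (hinv.mul (hasFDerivAt_coord 1 p)).neg
  have h2 : HasFDerivAt (fun x => inv1 x 2) (pr 2) p := by simpa using hasFDerivAt_coord 2 p
  have h3 : HasFDerivAt (fun x => inv1 x 3) (pr 3) p := by simpa using hasFDerivAt_coord 3 p
  have e0 := congrArg (fun L : E4 →L[ℝ] ℝ => L v) ((hD 0).unique h0)
  have e1 := congrArg (fun L : E4 →L[ℝ] ℝ => L v) ((hD 1).unique h1)
  have e2 := congrArg (fun L : E4 →L[ℝ] ℝ => L v) ((hD 2).unique h2)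
  have e3 := congrArg (fun L : E4 →L[ℝ] ℝ => L v) ((hD 3).unique h3)
  simp only [ContinuousLinearMap.comp_apply, _root_.add_apply,
    _root_.neg_apply, FunLike.coe_smul, Pi.smul_apply, smul_eq_mul, hQv] at e0 e1 e2 e3
  refine ⟨?_, ?_, ?_, ?_⟩
  · rw [show fderiv ℝ inv1 p v 0 = (pr 0) (fderiv ℝ inv1 p v) from rfl, e0]
    simp [a1, b1]
    field_simp
    rw [r1_def]; ring
  · rw [show fderiv ℝ inv1 p v 1 = (pr 1) (fderiv ℝ inv1 p v) from rfl, e1]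
    simp [a1, b1]
    field_simp
    rw [r1_def]; ring
  · rw [show fderiv ℝ inv1 p v 2 = (pr 2) (fderiv ℝ inv1 p v) from rfl, e2]; rfl
  · rw [show fderiv ℝ inv1 p v 3 = (pr 3) (fderiv ℝ inv1 p v) from rfl, e3]; rfl

/-- **The derivative of `inv2` in coordinates** (identity on `dz₁`, `-1/z₂² = a2 + i b2` on
`dz₂`). [folklore] -/
theorem fderiv_inv2_apply {p : E4} (h : r2 p ≠ 0) (v : E4) :
    fderiv ℝ inv2 p v 0 = v 0 ∧ fderiv ℝ inv2 p v 1 = v 1 ∧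
      fderiv ℝ inv2 p v 2 = a2 p * v 2 - b2 p * v 3 ∧
      fderiv ℝ inv2 p v 3 = b2 p * v 2 + a2 p * v 3 := by
  have hd := differentiableAt_inv2 h
  have hD : ∀ i, HasFDerivAt (fun x => inv2 x i) (pr i ∘L fderiv ℝ inv2 p) p := fun i =>
    (hasFDerivWithinAt_euclidean.1 hd.hasFDerivAt.hasFDerivWithinAt i).hasFDerivAt_of_univ
  set N : E4 →L[ℝ] ℝ := p 2 • pr 2 + p 2 • pr 2 + (p 3 • pr 3 + p 3 • pr 3) with hN
  set Q : E4 →L[ℝ] ℝ := (-(r2 p ^ 2)⁻¹) • N with hQ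
  have hinv : HasFDerivAt (fun x => (r2 x)⁻¹) Q p := by
    have := (hasDerivAt_inv h).comp_hasFDerivAt p (hasFDerivAt_r2 p)
    exact this.congr_fderiv (by ext v; simp [hQ, hN])
  have hNv : N v = 2 * (p 2 * v 2 + p 3 * v 3) := by
    simp [hN]; ring
  have hQv : Q v = -(r2 p ^ 2)⁻¹ * (2 * (p 2 * v 2 + p 3 * v 3)) := by
    simp only [hQ, FunLike.coe_smul, Pi.smul_apply, hNv, smul_eq_mul]
  have h0 : HasFDerivAt (fun x => inv2 x 0) (pr 0) p := by simpa using hasFDerivAt_coord 0 p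
  have h1 : HasFDerivAt (fun x => inv2 x 1) (pr 1) p := by simpa using hasFDerivAt_coord 1 p
  have h2 : HasFDerivAt (fun x => inv2 x 2) ((r2 p)⁻¹ • pr 2 + p 2 • Q) p := by
    simpa [Pi.mul_def, div_eq_inv_mul] using hinv.mul (hasFDerivAt_coord 2 p)
  have h3 : HasFDerivAt (fun x => inv2 x 3) (-((r2 p)⁻¹ • pr 3 + p 3 • Q)) p := by
    simpa [Pi.mul_def, div_eq_inv_mul, neg_div, Pi.neg_def] using
      (hinv.mul (hasFDerivAt_coord 3 p)).neg
  have e0 := congrArg (fun L : E4 →L[ℝ] ℝ => L v) ((hD 0).unique h0)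
  have e1 := congrArg (fun L : E4 →L[ℝ] ℝ => L v) ((hD 1).unique h1)
  have e2 := congrArg (fun L : E4 →L[ℝ] ℝ => L v) ((hD 2).unique h2)
  have e3 := congrArg (fun L : E4 →L[ℝ] ℝ => L v) ((hD 3).unique h3)
  simp only [ContinuousLinearMap.comp_apply, _root_.add_apply,
    _root_.neg_apply, FunLike.coe_smul, Pi.smul_apply, smul_eq_mul, hQv] at e0 e1 e2 e3
  refine ⟨?_, ?_, ?_, ?_⟩
  · rw [show fderiv ℝ inv2 p v 0 = (pr 0) (fderiv ℝ inv2 p v) from rfl, e0]; rfl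
  · rw [show fderiv ℝ inv2 p v 1 = (pr 1) (fderiv ℝ inv2 p v) from rfl, e1]; rfl
  · rw [show fderiv ℝ inv2 p v 2 = (pr 2) (fderiv ℝ inv2 p v) from rfl, e2]
    simp [a2, b2]
    field_simp
    rw [r2_def]; ring
  · rw [show fderiv ℝ inv2 p v 3 = (pr 3) (fderiv ℝ inv2 p v) from rfl, e3]
    simp [a2, b2]
    field_simp
    rw [r2_def]; ring

end CapModel

/-- **Registered helper sub-goal `helper_capModelInv1`** (first auxiliary file of stub `stub_capModel`):
the complex inversion `(z₁, z₂) ↦ (1/z₁, z₂)` of the signature is an involution off the axis `z₁ = 0`.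
[folklore] -/
theorem helper_capModelInv1 : ∀ p : EuclideanSpace ℝ (Fin 4), p 0 ^ 2 + p 1 ^ 2 ≠ 0 →
    (fun q : EuclideanSpace ℝ (Fin 4) => (WithLp.toLp 2 ![q 0 / (q 0 ^ 2 + q 1 ^ 2),
      -(q 1) / (q 0 ^ 2 + q 1 ^ 2), q 2, q 3] : EuclideanSpace ℝ (Fin 4)))
      (WithLp.toLp 2 ![p 0 / (p 0 ^ 2 + p 1 ^ 2), -(p 1) / (p 0 ^ 2 + p 1 ^ 2), p 2, p 3]) = p :=
  fun _ hp => CapModel.inv1_inv1 hp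

end Summit.SmoothPoincare4.SmoothPoincare4.Theorems.GromovRecognitionRelEnd.CrossCapLaurent
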